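import Summits.Parity.GeneralizedHardyLittlewood.Theorems.LiouvilleShiftedTablesEngineToPairsSieveTriple

/-!
# Correlation sieve for line `Sketch` of the crux `EngineToPairs` (stmt-Parity-14659), part 3b:
# the generic Type-I₂ dispatch

Support file for the stub `stub_sieve : CorrelationSieveFamily`, continuing part 3a
(`…EngineToPairsSieveTriple`: `sum_Ioc_typeI2_shape`).

* `typeI2_dispatch_one`, `typeI2_dispatch_log` — `α` supported on `r ≤ R` with `|α| ≤ L_a τ^B`, `σ` the
  indicator of `(S_a, S_b]` (times `log`), `τ = 1_{(V, ∞)}` with `2 R S_b V ≤ x`: the family sum of the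
  functional is `≤ 2 L_a · TI2` (resp. `≤ 4 L_a log x · TI2`) under `TypeI2Fam … TI2` — the flat `s`-range
  by differencing `S`, the `log s` by the explicit Abel identity (`sum_Ioc_mul_eq_abel`) with breakpoints
  COMMON to all `(q, r)`, each partial sum being a difference of two flat Type-I₂ sums.
-/

noncomputable section

namespace Summit.Parity.GeneralizedHardyLittlewood.Theorems.EngineToPairs.Sieve

open Finset Real
open Literature.NumberTheory.Sieve

section TypeI2

variable {Qs : Finset ℕ} {w : ℕ → ℕ → ℝ} {x ρ σ' : ℝ} {B : ℕ} {TI2 : ℝ}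

/-- **Type-I₂ dispatch, constant coefficient on the flat variable.**  `α` supported on `r ≤ R`
(`1 ≤ R ≤ x^ρ`, `R ≤ x`) with `|α| ≤ L_a τ^B`; `σ = 1_{(S_a, S_b]}` with `S_b R ≤ x^{1/2+σ'}`, `S_b ≤ x`;
`τ = 1_{(V, ∞)}` with `V ≥ 0` and `2 R S_b V ≤ x`.  Under `TypeI2Fam Qs w x ρ σ' B TI2`:
`∑_{q} |∑_{x/2<n≤x} (α ⋆ σ ⋆ τ)(n) w_q(n)| ≤ 2 L_a TI2`. [this line] -/
theorem typeI2_dispatch_one (hfam : TypeI2Fam Qs w x ρ σ' B TI2) (hx : 1 ≤ x)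
    (α σf τf : ArithmeticFunction ℝ) {La R V : ℝ} (hLa : 0 < La) (hR1 : 1 ≤ R) (hRx : R ≤ x ^ ρ)
    (hRxle : R ≤ x) (hαsupp : ∀ r, α r ≠ 0 → (r : ℝ) ≤ R) (hα : ∀ r, |α r| ≤ La * tauPow B r)
    {Sa Sb : ℕ} (hSab : Sa ≤ Sb) (hSb : (Sb : ℝ) * R ≤ x ^ (1 / 2 + σ')) (hSbx : (Sb : ℝ) ≤ x)
    (hσ : ∀ s, σf s = if Sa < s ∧ s ≤ Sb then 1 else 0)
    (hτ : ∀ t, τf t = if V < (t : ℝ) then 1 else 0) (hvac : 2 * R * Sb * V ≤ x) :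
    ∑ q ∈ Qs, |∑ n ∈ Ioc ⌊x / 2⌋₊ ⌊x⌋₊, (α * σf * τf) n * w q n| ≤ 2 * La * TI2 := by
  classical
  have hx0 : 0 ≤ x := by linarith
  set I2 : ℕ → ℕ → ℕ → ℝ := fun q r S => ∑ s ∈ Icc 1 S, ∑ t ∈ (Icc 1 ⌊x / (s * r)⌋₊).filter
      (fun t : ℕ => x / 2 < (r : ℝ) * s * t), w q (r * s * t) with hI2
  -- the family bound at a flat height `S ≤ S_b`
  have hFam : ∀ S : ℕ, S ≤ Sb → ∑ q ∈ Qs, ∑ r ∈ Icc 1 ⌊R⌋₊, tauPow B r * |I2 q r S| ≤ TI2 := by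
    intro S hS
    have hS' : (S : ℝ) * R ≤ x ^ (1 / 2 + σ') :=
      le_trans (mul_le_mul_of_nonneg_right (by exact_mod_cast hS) (by linarith)) hSb
    have := hfam R S x hR1 hRx (Nat.cast_nonneg S) hS' hx0 le_rfl
    simpa only [Nat.floor_natCast, hI2] using this
  -- each functional as an `r`-sum of differences
  have hq : ∀ q ∈ Qs, |∑ n ∈ Ioc ⌊x / 2⌋₊ ⌊x⌋₊, (α * σf * τf) n * w q n| ≤
      La * ∑ r ∈ Icc 1 ⌊R⌋₊, tauPow B r * |I2 q r Sb| + La * ∑ r ∈ Icc 1 ⌊R⌋₊, tauPow B r * |I2 q r Sa| := by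
    intro q _
    rw [sum_Ioc_typeI2_shape hx α σf τf hR1 hRxle hαsupp hSbx (fun _ => (1 : ℝ))
      (by simpa using hσ) hτ hvac (w q)]
    have hdiff : ∀ r ∈ Icc 1 ⌊R⌋₊, ∑ s ∈ Ioc Sa Sb, (1 : ℝ) *
        ∑ t ∈ (Icc 1 ⌊x / (s * r)⌋₊).filter (fun t : ℕ => x / 2 < (r : ℝ) * s * t), w q (r * s * t) =
        I2 q r Sb - I2 q r Sa := by
      intro r _
      simp only [one_mul, hI2]
      rw [sum_Icc_one_eq_add_sum_Ioc hSab]; ring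
    rw [Finset.sum_congr rfl (fun r hr => by rw [hdiff r hr]), Finset.mul_sum, Finset.mul_sum,
      ← Finset.sum_add_distrib]
    refine (Finset.abs_sum_le_sum_abs _ _).trans (Finset.sum_le_sum fun r _ => ?_)
    rw [abs_mul]
    have h1 : |I2 q r Sb - I2 q r Sa| ≤ |I2 q r Sb| + |I2 q r Sa| := abs_sub _ _
    have h2 : |α r| ≤ La * tauPow B r := hα r
    have h3 : 0 ≤ tauPow B r := tauPow_nonneg B r
    calc |α r| * |I2 q r Sb - I2 q r Sa| ≤ (La * tauPow B r) * (|I2 q r Sb| + |I2 q r Sa|) :=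
          mul_le_mul h2 h1 (abs_nonneg _) (by positivity)
      _ = La * (tauPow B r * |I2 q r Sb|) + La * (tauPow B r * |I2 q r Sa|) := by ring
  refine (Finset.sum_le_sum hq).trans ?_
  rw [Finset.sum_add_distrib, ← Finset.mul_sum, ← Finset.mul_sum]
  have hb := hFam Sb le_rfl
  have ha := hFam Sa hSab
  nlinarith

/-- **Abel summation, explicit form on `(S_a, S_b]`**: with `A(u) = ∑_{S_a<s≤u} g(s)`,
`∑_{S_a<s≤S_b} f(s) g(s) = f(S_b) A(S_b) − ∑_{S_a≤u<S_b} (f(u+1) − f(u)) A(u)`. [folklore] -/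
theorem sum_Ioc_mul_eq_abel (f g : ℕ → ℝ) {Sa Sb : ℕ} (h : Sa ≤ Sb) :
    ∑ s ∈ Ioc Sa Sb, f s * g s =
      f Sb * ∑ s ∈ Ioc Sa Sb, g s - ∑ u ∈ Ico Sa Sb, (f (u + 1) - f u) * ∑ s ∈ Ioc Sa u, g s := by
  induction Sb, h using Nat.le_induction with
  | base => simp
  | succ n hn ih =>
    rw [Finset.sum_Ioc_succ_top hn, Finset.sum_Ioc_succ_top hn, Finset.sum_Ico_succ_top hn, ih]
    ring

/-- Telescoping: `∑_{S_a≤u<S_b} (f(u+1) − f(u)) = f(S_b) − f(S_a)`. [folklore] -/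
theorem sum_Ico_sub_telescope (f : ℕ → ℝ) {Sa Sb : ℕ} (h : Sa ≤ Sb) :
    ∑ u ∈ Ico Sa Sb, (f (u + 1) - f u) = f Sb - f Sa := by
  induction Sb, h using Nat.le_induction with
  | base => simp
  | succ n hn ih => rw [Finset.sum_Ico_succ_top hn, ih]; ring

/-- **Type-I₂ dispatch, logarithmic coefficient on the flat variable.**  As `typeI2_dispatch_one` but with
`σ = log · 1_{(S_a, S_b]}`: `∑_{q} |∑_{x/2<n≤x} (α ⋆ σ ⋆ τ)(n) w_q(n)| ≤ 4 L_a log x · TI2` (explicit Abel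
summation in `s` with breakpoints common to all `(q, r)`, each partial sum a difference of two flat
Type-I₂ sums). [this line] -/
theorem typeI2_dispatch_log (hfam : TypeI2Fam Qs w x ρ σ' B TI2) (hx : 1 ≤ x)
    (α σf τf : ArithmeticFunction ℝ) {La R V : ℝ} (hLa : 0 < La) (hR1 : 1 ≤ R) (hRx : R ≤ x ^ ρ)
    (hRxle : R ≤ x) (hαsupp : ∀ r, α r ≠ 0 → (r : ℝ) ≤ R) (hα : ∀ r, |α r| ≤ La * tauPow B r)
    {Sa Sb : ℕ} (hSab : Sa ≤ Sb) (hSb : (Sb : ℝ) * R ≤ x ^ (1 / 2 + σ')) (hSbx : (Sb : ℝ) ≤ x)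
    (hσ : ∀ s, σf s = if Sa < s ∧ s ≤ Sb then Real.log s else 0)
    (hτ : ∀ t, τf t = if V < (t : ℝ) then 1 else 0) (hvac : 2 * R * Sb * V ≤ x) :
    ∑ q ∈ Qs, |∑ n ∈ Ioc ⌊x / 2⌋₊ ⌊x⌋₊, (α * σf * τf) n * w q n| ≤ 4 * La * Real.log x * TI2 := by
  classical
  have hx0 : 0 ≤ x := by linarith
  have hlogx : 0 ≤ Real.log x := Real.log_nonneg hx
  set I2 : ℕ → ℕ → ℕ → ℝ := fun q r S => ∑ s ∈ Icc 1 S, ∑ t ∈ (Icc 1 ⌊x / (s * r)⌋₊).filter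
      (fun t : ℕ => x / 2 < (r : ℝ) * s * t), w q (r * s * t) with hI2
  set Fam : ℕ → ℝ := fun S => ∑ q ∈ Qs, ∑ r ∈ Icc 1 ⌊R⌋₊, tauPow B r * |I2 q r S| with hFamdef
  have hFam : ∀ S : ℕ, S ≤ Sb → Fam S ≤ TI2 := by
    intro S hS
    have hS' : (S : ℝ) * R ≤ x ^ (1 / 2 + σ') :=
      le_trans (mul_le_mul_of_nonneg_right (by exact_mod_cast hS) (by linarith)) hSb
    have := hfam R S x hR1 hRx (Nat.cast_nonneg S) hS' hx0 le_rfl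
    simpa only [Nat.floor_natCast, hI2, hFamdef] using this
  have hFam0 : ∀ S, 0 ≤ Fam S := fun S => Finset.sum_nonneg fun q _ =>
    Finset.sum_nonneg fun r _ => mul_nonneg (tauPow_nonneg B r) (abs_nonneg _)
  have hTI2 : 0 ≤ TI2 := (hFam0 Sb).trans (hFam Sb le_rfl)
  -- log facts
  have hlogSb : Real.log (Sb : ℝ) ≤ Real.log x := by
    rcases Nat.eq_zero_or_pos Sb with h0 | hpos
    · rw [h0]; simp [hlogx]
    · exact Real.log_le_log (by exact_mod_cast hpos) hSbx
  have hlogSb0 : 0 ≤ Real.log (Sb : ℝ) := Real.log_natCast_nonneg _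
  have hstep0 : ∀ u : ℕ, 0 ≤ Real.log ((u : ℝ) + 1) - Real.log u := by
    intro u
    have := monotone_log_natCast (Nat.le_succ u)
    simp only [Nat.cast_succ] at this
    linarith
  have htel : ∑ u ∈ Ico Sa Sb, (Real.log ((u : ℝ) + 1) - Real.log u) ≤ Real.log x := by
    have := sum_Ico_sub_telescope (fun u : ℕ => Real.log (u : ℝ)) hSab
    simp only [Nat.cast_succ] at this ⊢
    have h0 : 0 ≤ Real.log (Sa : ℝ) := Real.log_natCast_nonneg _
    linarith
  -- pointwise bound for each `q`
  have hq : ∀ q ∈ Qs, |∑ n ∈ Ioc ⌊x / 2⌋₊ ⌊x⌋₊, (α * σf * τf) n * w q n| ≤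
      La * (Real.log (Sb : ℝ) * ∑ r ∈ Icc 1 ⌊R⌋₊, tauPow B r * (|I2 q r Sb| + |I2 q r Sa|)) +
      La * ∑ u ∈ Ico Sa Sb, (Real.log ((u : ℝ) + 1) - Real.log u) *
        ∑ r ∈ Icc 1 ⌊R⌋₊, tauPow B r * (|I2 q r u| + |I2 q r Sa|) := by
    intro q _
    rw [sum_Ioc_typeI2_shape hx α σf τf hR1 hRxle hαsupp hSbx (fun s => Real.log (s : ℝ)) hσ hτ
      hvac (w q)]
    -- Abel on the `s`-sum, for each `r`
    have habel : ∀ r ∈ Icc 1 ⌊R⌋₊, ∑ s ∈ Ioc Sa Sb, Real.log (s : ℝ) *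
        ∑ t ∈ (Icc 1 ⌊x / (s * r)⌋₊).filter (fun t : ℕ => x / 2 < (r : ℝ) * s * t), w q (r * s * t) =
        Real.log (Sb : ℝ) * (I2 q r Sb - I2 q r Sa) -
          ∑ u ∈ Ico Sa Sb, (Real.log ((u : ℝ) + 1) - Real.log u) * (I2 q r u - I2 q r Sa) := by
      intro r _
      rw [sum_Ioc_mul_eq_abel (fun s : ℕ => Real.log (s : ℝ)) _ hSab]
      have hA : ∀ u, Sa ≤ u → ∑ s ∈ Ioc Sa u, ∑ t ∈ (Icc 1 ⌊x / (s * r)⌋₊).filter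
          (fun t : ℕ => x / 2 < (r : ℝ) * s * t), w q (r * s * t) = I2 q r u - I2 q r Sa := by
        intro u hu
        simp only [hI2]
        rw [sum_Icc_one_eq_add_sum_Ioc hu]; ring
      rw [hA Sb hSab]
      congr 1
      refine Finset.sum_congr rfl fun u hu => ?_
      rw [hA u (Finset.mem_Ico.1 hu).1]
      simp only [Nat.cast_succ]
    rw [Finset.sum_congr rfl (fun r hr => by rw [habel r hr])]
    -- now bound absolutely, termwise in `r`
    set X : ℕ → ℝ := fun r => |I2 q r Sb| + |I2 q r Sa| with hX
    set Z : ℕ → ℕ → ℝ := fun r u => |I2 q r u| + |I2 q r Sa| with hZ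
    set cu : ℕ → ℝ := fun u => Real.log ((u : ℝ) + 1) - Real.log u with hcu
    have hterm : ∀ r ∈ Icc 1 ⌊R⌋₊, |α r * (Real.log (Sb : ℝ) * (I2 q r Sb - I2 q r Sa) -
        ∑ u ∈ Ico Sa Sb, cu u * (I2 q r u - I2 q r Sa))| ≤
        La * tauPow B r * (Real.log (Sb : ℝ) * X r + ∑ u ∈ Ico Sa Sb, cu u * Z r u) := by
      intro r _
      have h3 : 0 ≤ tauPow B r := tauPow_nonneg B r
      rw [abs_mul]
      have hin : |Real.log (Sb : ℝ) * (I2 q r Sb - I2 q r Sa) -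
          ∑ u ∈ Ico Sa Sb, cu u * (I2 q r u - I2 q r Sa)| ≤
          Real.log (Sb : ℝ) * X r + ∑ u ∈ Ico Sa Sb, cu u * Z r u := by
        refine (abs_sub _ _).trans (add_le_add ?_ ?_)
        · rw [abs_mul, abs_of_nonneg hlogSb0]
          exact mul_le_mul_of_nonneg_left (abs_sub _ _) hlogSb0
        · refine (Finset.abs_sum_le_sum_abs _ _).trans (Finset.sum_le_sum fun u _ => ?_)
          rw [abs_mul, abs_of_nonneg (hstep0 u)]
          exact mul_le_mul_of_nonneg_left (abs_sub _ _) (hstep0 u)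
      have hnn : 0 ≤ Real.log (Sb : ℝ) * X r + ∑ u ∈ Ico Sa Sb, cu u * Z r u := by
        refine add_nonneg (mul_nonneg hlogSb0 (by positivity))
          (Finset.sum_nonneg fun u _ => mul_nonneg (hstep0 u) (by positivity))
      exact mul_le_mul (hα r) hin (abs_nonneg _) (by positivity)
    refine (Finset.abs_sum_le_sum_abs _ _).trans ((Finset.sum_le_sum hterm).trans (le_of_eq ?_))
    -- rearrange `∑_r La τ_r (L X_r + ∑_u c_u Z_{r,u}) = La (L ∑_r τ_r X_r) + La ∑_u c_u ∑_r τ_r Z_{r,u}`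
    have e1 : ∑ r ∈ Icc 1 ⌊R⌋₊, La * tauPow B r * (Real.log (Sb : ℝ) * X r + ∑ u ∈ Ico Sa Sb, cu u * Z r u) =
        ∑ r ∈ Icc 1 ⌊R⌋₊, La * (Real.log (Sb : ℝ) * (tauPow B r * X r)) +
        ∑ r ∈ Icc 1 ⌊R⌋₊, ∑ u ∈ Ico Sa Sb, La * (cu u * (tauPow B r * Z r u)) := by
      rw [← Finset.sum_add_distrib]
      refine Finset.sum_congr rfl fun r _ => ?_
      rw [mul_add, Finset.mul_sum]
      congr 1
      · ring
      · exact Finset.sum_congr rfl fun u _ => by ring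
    have eA : ∑ r ∈ Icc 1 ⌊R⌋₊, La * (Real.log (Sb : ℝ) * (tauPow B r * X r)) =
        La * (Real.log (Sb : ℝ) * ∑ r ∈ Icc 1 ⌊R⌋₊, tauPow B r * X r) := by
      rw [Finset.mul_sum, Finset.mul_sum]
    have eB : ∑ r ∈ Icc 1 ⌊R⌋₊, ∑ u ∈ Ico Sa Sb, La * (cu u * (tauPow B r * Z r u)) =
        La * ∑ u ∈ Ico Sa Sb, cu u * ∑ r ∈ Icc 1 ⌊R⌋₊, tauPow B r * Z r u := by
      rw [Finset.sum_comm, Finset.mul_sum]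
      refine Finset.sum_congr rfl fun u _ => ?_
      rw [Finset.mul_sum, Finset.mul_sum]
    rw [e1, eA, eB]
  -- sum over `q`
  refine (Finset.sum_le_sum hq).trans ?_
  have hsplit1 : ∀ S, ∑ q ∈ Qs, ∑ r ∈ Icc 1 ⌊R⌋₊, tauPow B r * (|I2 q r S| + |I2 q r Sa|) = Fam S + Fam Sa := by
    intro S
    simp only [hFamdef]
    rw [← Finset.sum_add_distrib]
    refine Finset.sum_congr rfl fun q _ => ?_
    rw [← Finset.sum_add_distrib]
    exact Finset.sum_congr rfl fun r _ => by ring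
  rw [Finset.sum_add_distrib, ← Finset.mul_sum, ← Finset.mul_sum, ← Finset.mul_sum, hsplit1 Sb,
    Finset.sum_comm]
  have hinner : ∑ u ∈ Ico Sa Sb, ∑ q ∈ Qs, (Real.log ((u : ℝ) + 1) - Real.log u) *
      ∑ r ∈ Icc 1 ⌊R⌋₊, tauPow B r * (|I2 q r u| + |I2 q r Sa|) ≤
      ∑ u ∈ Ico Sa Sb, (Real.log ((u : ℝ) + 1) - Real.log u) * (2 * TI2) := by
    refine Finset.sum_le_sum fun u hu => ?_
    rw [← Finset.mul_sum, hsplit1 u]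
    have hu : u ≤ Sb := (Finset.mem_Ico.1 hu).2.le
    have := hFam u hu
    have := hFam Sa hSab
    exact mul_le_mul_of_nonneg_left (by linarith) (hstep0 u)
  have h1 : La * (Real.log (Sb : ℝ) * (Fam Sb + Fam Sa)) ≤ La * (Real.log x * (2 * TI2)) := by
    refine mul_le_mul_of_nonneg_left ?_ hLa.le
    have := hFam Sb le_rfl
    have := hFam Sa hSab
    exact mul_le_mul hlogSb (by linarith) (add_nonneg (hFam0 _) (hFam0 _)) hlogx
  have h2 : La * ∑ u ∈ Ico Sa Sb, ∑ q ∈ Qs, (Real.log ((u : ℝ) + 1) - Real.log u) *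
      ∑ r ∈ Icc 1 ⌊R⌋₊, tauPow B r * (|I2 q r u| + |I2 q r Sa|) ≤ La * (Real.log x * (2 * TI2)) := by
    refine mul_le_mul_of_nonneg_left (hinner.trans ?_) hLa.le
    rw [← Finset.sum_mul]
    exact mul_le_mul_of_nonneg_right htel (by positivity)
  linarith

end TypeI2

end Summit.Parity.GeneralizedHardyLittlewood.Theorems.EngineToPairs.Sieve

namespace Summit.Parity.GeneralizedHardyLittlewood.Theorems.EngineToPairs

/-- Registered sub-goal of `stub_sieve` carried by this part (landing mechanics): telescoping over
`Ico` (used by the Abel step of `Sieve.typeI2_dispatch_log`). [folklore] -/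
theorem sieve_part3_anchor : ∀ (f : ℕ → ℝ) (Sa Sb : ℕ), Sa ≤ Sb →
    ∑ u ∈ Finset.Ico Sa Sb, (f (u + 1) - f u) = f Sb - f Sa :=
  fun f _ _ h => Sieve.sum_Ico_sub_telescope f h

end Summit.Parity.GeneralizedHardyLittlewood.Theorems.EngineToPairs

end
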